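import Literature.Probability.Percolation.EnhancementAGLine
import Literature.Probability.Percolation.EnhancedClusterModification
import Literature.Probability.Percolation.CoveringQuotientBlocks
import Literature.Probability.Percolation.ProdBernoulliRusso
import Literature.Probability.Percolation.BernoulliPercolationProofs
import Literature.Probability.Percolation.PercolationProofs
import HarnessLib

/-!
# Proposition 4.2 of Martineau–Severo (2019): the exploratory enhancement percolates below `p_c(ℋ)`

Support file of the inline proof of `Literature.Probability.Percolation.MartineauSevero2019_cor22`.
Martineau–Severo (Ann. Probab. 47 (2019), §4 and §6):

> **Proposition 4.2.** Assume further that `p_c(ℋ) < 1`. Then, for any choice of `r ≥ 1`, the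
> following holds: for every `s ∈ (0,1]`, there exists `p_s < p_c(ℋ)` such that for every
> `p ∈ [p_s, 1]`, the cluster `𝒞_ℋ^{p,s}(o)` is infinite with positive probability.

proved in §6 from Lemma 6.1 through the differential inequality (diffineq) and the line-segment
argument. Here `ℋ` is a connected, locally finite graph on a countable vertex type all of whose
degrees are `≤ D`, the enhanced cluster and the events `𝓔_L` are those of `EnhancedCluster.lean`
(`enhCluster`, `enhEvent`), Lemma 6.1 is `exists_local_modification`
(`EnhancedClusterModification.lean`), and the analytic §6 steps are `EnhancementAGLine.lean`. We prove
the proposition in the finite-volume form consumed by the §4 assembly: with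
`ℙ_{p,s} = enhMeasure ℋ p s` (`Ber(p)^{⊗E(ℋ)} ⊗ Ber(s)^{⊗V(ℋ)}` on the joint coordinates),

  `∀ ε ∈ (0, p_c(ℋ)), ∀ s ∈ (0, 1], ∃ p ∈ [ε, p_c(ℋ)), ∃ η > 0, ∀ L ≥ r+1, ℙ_{p,s}(𝓔_L) ≥ η`

(`EnhProp42.exists_lt_criticalProb_enhEvent_ge`; `η = θ_ℋ(o, p₀)` for a `p₀ > p_c(ℋ)` on the
segment, exactly as in the printed proof: `θ(p_s,s) ≥ … ≥ θ(p₀, 0) > 0`).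

Contents: the local modification property `AGLine.LocMod` for `𝓔_L` on the window
`enhWindow = E(B_{L+r}(o)) ⊔ B_L(o)` from Lemma 6.1 (`locMod_enhEvent`), with the uniform bounds
`N_E, N_V, N_M` from the degree bound; the identification of the polynomial `Θ_L(p, s)` with
`ℙ_{p,s}(𝓔_L)` (`theta_eq_enhMeasure_real`, cylinder formula `prodBernoulli_real_eq_sum_powerset`);
`θ_ℋ(o, p) ≤ ℙ_{p,s}(𝓔_L)` (the `ω`-cluster is contained in the enhanced cluster; the edge marginal
of `ℙ_{p,s}` is `P_p^ℋ`, `StarCoins.prodBernoulli_map_inlPart`); and the constants of the segment.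

## References

* S. Martineau, F. Severo, Ann. Probab. 47 (2019), §4 Prop. 4.2, §6 (proof) [MartineauSevero2019].
* M. Aizenman, G. Grimmett, J. Stat. Phys. 63 (1991) 817–835 [AizenmanGrimmett1991].
-/

noncomputable section

namespace Literature.Probability.Percolation

open MeasureTheory ProbabilityTheory LatticeModels Literature.Barriers.CriticalPhenomena
open scoped ENNReal Classical

namespace EnhProp42

variable {Q : Type*} {H : SimpleGraph Q}

/-! ### Cardinality bookkeeping under a degree bound -/

/-- `|ballFin| = ballVolume`. [folklore] -/
theorem card_ballFin [H.LocallyFinite] (u : Q) (n : ℕ) : (ballFin H u n).card = ballVolume H u n := by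
  rw [ballVolume, ballFin, Set.ncard_eq_toFinset_card _ (graphBall_finite H u n)]

/-- `|B_n(u)| ≤ (D+1)^n` for the finset ball. [folklore] -/
theorem card_ballFin_le_pow [H.LocallyFinite] {D : ℕ} (hD : ∀ v, H.degree v ≤ D) (u : Q) (n : ℕ) :
    (ballFin H u n).card ≤ (D + 1) ^ n := by
  rw [card_ballFin]
  exact ballVolume_le_pow_of_degree_le H hD u n

/-- The edges inside a ball are pairs of ball points: `|E(B_n(u))| ≤ (|B_n(u)| + 1)^2`. [folklore] -/
theorem card_edgesInBallFin_le [H.LocallyFinite] (u : Q) (n : ℕ) :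
    (edgesInBallFin H u n).card ≤ ((ballFin H u n).card + 1) ^ 2 := by
  have hsub : edgesInBallFin H u n ⊆ ((ballFin H u n) ×ˢ (ballFin H u n)).image fun p => s(p.1, p.2) := by
    intro e he
    rw [mem_edgesInBallFin] at he
    induction e using Sym2.inductionOn with
    | hf a b =>
      obtain ⟨-, ha, hb⟩ := mk_mem_edgesInBall_iff.1 he
      exact Finset.mem_image.2 ⟨(a, b), Finset.mem_product.2 ⟨mem_ballFin.2 ha, mem_ballFin.2 hb⟩, rfl⟩
  calc (edgesInBallFin H u n).card
      ≤ (((ballFin H u n) ×ˢ (ballFin H u n)).image fun p => s(p.1, p.2)).card := Finset.card_le_card hsub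
    _ ≤ ((ballFin H u n) ×ˢ (ballFin H u n)).card := Finset.card_image_le
    _ = (ballFin H u n).card * (ballFin H u n).card := Finset.card_product _ _
    _ ≤ ((ballFin H u n).card + 1) ^ 2 := by nlinarith

/-- `|E(B_n(u))| ≤ ((D+1)^n + 1)^2`. [folklore] -/
theorem card_edgesInBallFin_le_pow [H.LocallyFinite] {D : ℕ} (hD : ∀ v, H.degree v ≤ D) (u : Q) (n : ℕ) :
    (edgesInBallFin H u n).card ≤ ((D + 1) ^ n + 1) ^ 2 :=
  (card_edgesInBallFin_le u n).trans (Nat.pow_le_pow_left (Nat.add_le_add_right (card_ballFin_le_pow hD u n) 1) 2)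

/-! ### The modification windows as finsets -/

section Windows

variable (H) [H.LocallyFinite] (r : ℕ)

/-- A chosen ordered pair of endpoints of an unordered pair. [folklore] -/
def ends (e : Sym2 Q) : Q × Q := Quot.out e

/-- The edge coordinates that a modification at `e` may change: edges within `2r+2` of an endpoint.
[cite: MartineauSevero2019, Lemma 6.1 (B_R(e))] -/
def CE (e : Sym2 Q) : Finset (Sym2 Q) :=
  edgesInBallFin H (ends e).1 (2 * r + 2) ∪ edgesInBallFin H (ends e).2 (2 * r + 2)

/-- The mark coordinates that a modification at `e` may change (and where the `s`-pivotal vertex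
lies): vertices within `3r+4` of an endpoint. [cite: MartineauSevero2019, Lemma 6.1 (z ∈ B_R(e))] -/
def CV (e : Sym2 Q) : Finset Q :=
  ballFin H (ends e).1 (3 * r + 4) ∪ ballFin H (ends e).2 (3 * r + 4)

variable {H r}

/-- `e = s((ends e).1, (ends e).2)`. [folklore] -/
theorem eq_mk_ends (e : Sym2 Q) : e = s((ends e).1, (ends e).2) := by
  conv_lhs => rw [← Quot.out_eq e]
  rfl

/-- The endpoints of `e` are the components of `ends e`. [folklore] -/
theorem mem_iff_out {e : Sym2 Q} {x : Q} : x ∈ e ↔ x = (ends e).1 ∨ x = (ends e).2 := by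
  conv_lhs => rw [eq_mk_ends e]
  exact Sym2.mem_iff

/-- The modification window of Lemma 6.1 lies inside `CE ⊔ CV`. [folklore] -/
theorem modWindow_subset {e : Sym2 Q} {i : Sym2 Q ⊕ Q} (hi : i ∈ modWindow H r e) :
    i ∈ (CE H r e).disjSum (CV H r e) := by
  obtain ⟨x, hx, hi⟩ := hi
  rcases hi with ⟨f, hf, rfl⟩ | ⟨v, hv, rfl⟩
  · rw [Finset.inl_mem_disjSum, CE, Finset.mem_union, mem_edgesInBallFin, mem_edgesInBallFin]
    rcases mem_iff_out.1 hx with rfl | rfl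
    · exact Or.inl hf
    · exact Or.inr hf
  · rw [Finset.inr_mem_disjSum, CV, Finset.mem_union, mem_ballFin, mem_ballFin]
    rcases mem_iff_out.1 hx with rfl | rfl
    · exact Or.inl hv
    · exact Or.inr hv

/-- An edge coordinate outside `CE e` is outside the window. [folklore] -/
theorem inl_not_mem_modWindow {e f : Sym2 Q} (hf : f ∉ CE H r e) : (Sum.inl f : Sym2 Q ⊕ Q) ∉ modWindow H r e :=
  fun h => hf (Finset.inl_mem_disjSum.1 (modWindow_subset h))

/-- `|CE e| ≤ N_E := 2 ((D+1)^{2r+2} + 1)^2`. [folklore] -/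
theorem card_CE_le {D : ℕ} (hD : ∀ v, H.degree v ≤ D) (e : Sym2 Q) :
    (CE H r e).card ≤ 2 * ((D + 1) ^ (2 * r + 2) + 1) ^ 2 := by
  refine (Finset.card_union_le _ _).trans ?_
  have h1 := card_edgesInBallFin_le_pow hD (ends e).1 (2 * r + 2)
  have h2 := card_edgesInBallFin_le_pow hD (ends e).2 (2 * r + 2)
  omega

/-- `|CV e| ≤ N_V := 2 (D+1)^{3r+4}`. [folklore] -/
theorem card_CV_le {D : ℕ} (hD : ∀ v, H.degree v ≤ D) (e : Sym2 Q) :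
    (CV H r e).card ≤ 2 * (D + 1) ^ (3 * r + 4) := by
  refine (Finset.card_union_le _ _).trans ?_
  have h1 := card_ballFin_le_pow hD (ends e).1 (3 * r + 4)
  have h2 := card_ballFin_le_pow hD (ends e).2 (3 * r + 4)
  omega

/-- **Overlap**: an edge `e ∈ E(ℋ)` with `y ∈ CV e` lies inside `B_{3r+5}(y)`. [folklore] -/
theorem mem_edgesInBallFin_of_mem_CV {e : Sym2 Q} (he : e ∈ H.edgeSet) {y : Q} (hy : y ∈ CV H r e) :
    e ∈ edgesInBallFin H y (3 * r + 5) := by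
  rw [mem_edgesInBallFin]
  -- an endpoint `x` of `e` with `y ∈ B_{3r+4}(x)`
  obtain ⟨x, hx, hxy⟩ : ∃ x ∈ e, y ∈ graphBall H x (3 * r + 4) := by
    rw [CV, Finset.mem_union, mem_ballFin, mem_ballFin] at hy
    rcases hy with hy | hy
    · exact ⟨_, mem_iff_out.2 (Or.inl rfl), hy⟩
    · exact ⟨_, mem_iff_out.2 (Or.inr rfl), hy⟩
  refine ⟨he, ?_⟩
  have hx' : x ∈ graphBall H y (3 * r + 4) := mem_graphBall_symm hxy
  induction e using Sym2.inductionOn with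
  | hf a b =>
    have hab : H.Adj a b := he
    rcases Sym2.mem_iff.1 hx with rfl | rfl
    · exact Set.mk_mem_sym2_iff.2
        ⟨graphBall_mono _ _ (by omega) hx',
          graphBall_mono _ _ (by omega) (mem_graphBall_trans hx' (mem_graphBall_one_of_adj' hab))⟩
    · exact Set.mk_mem_sym2_iff.2
        ⟨graphBall_mono _ _ (by omega) (mem_graphBall_trans hx' (mem_graphBall_one_of_adj' hab.symm)),
          graphBall_mono _ _ (by omega) hx'⟩

/-- `#{e ∈ K_E : y ∈ CV e} ≤ N_M := ((D+1)^{3r+5} + 1)^2` for any finset `K_E` of edges of `ℋ`. [folklore] -/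
theorem card_filter_mem_CV_le {D : ℕ} (hD : ∀ v, H.degree v ≤ D) {KE : Finset (Sym2 Q)}
    (hKE : ∀ e ∈ KE, e ∈ H.edgeSet) (y : Q) :
    (KE.filter fun e => y ∈ CV H r e).card ≤ ((D + 1) ^ (3 * r + 5) + 1) ^ 2 := by
  refine le_trans (Finset.card_le_card fun e he => ?_) (card_edgesInBallFin_le_pow hD y (3 * r + 5))
  rw [Finset.mem_filter] at he
  exact mem_edgesInBallFin_of_mem_CV (hKE e he.1) he.2

end Windows

/-! ### Pivotality is decided on the window -/

/-- For an event determined by `K`, pivotality of `i` at `ω` only depends on `ω ∩ K`. [folklore] -/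
theorem isPivotal_iff_of_determinedBy {ι : Type*} {A : Set (Set ι)} {K : Set ι} (hA : DeterminedBy A K)
    (i : ι) {ω ω' : Set ι} (h : ω ∩ K = ω' ∩ K) : IsPivotal A i ω ↔ IsPivotal A i ω' := by
  rw [determinedBy_iff] at hA
  have h1 : insert i ω ∩ K = insert i ω' ∩ K := by
    ext j
    simp only [Set.mem_inter_iff, Set.mem_insert_iff]
    constructor
    · rintro ⟨rfl | hj, hjK⟩
      · exact ⟨Or.inl rfl, hjK⟩
      · exact ⟨Or.inr ((Set.ext_iff.1 h j).1 ⟨hj, hjK⟩).1, hjK⟩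
    · rintro ⟨rfl | hj, hjK⟩
      · exact ⟨Or.inl rfl, hjK⟩
      · exact ⟨Or.inr ((Set.ext_iff.1 h j).2 ⟨hj, hjK⟩).1, hjK⟩
  have h2 : (ω \ {i}) ∩ K = (ω' \ {i}) ∩ K := by
    ext j
    simp only [Set.mem_inter_iff, Set.mem_sdiff, Set.mem_singleton_iff]
    constructor
    · rintro ⟨⟨hj, hji⟩, hjK⟩
      exact ⟨⟨((Set.ext_iff.1 h j).1 ⟨hj, hjK⟩).1, hji⟩, hjK⟩
    · rintro ⟨⟨hj, hji⟩, hjK⟩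
      exact ⟨⟨((Set.ext_iff.1 h j).2 ⟨hj, hjK⟩).1, hji⟩, hjK⟩
  unfold IsPivotal
  rw [hA _ _ h1, hA _ _ h2]

/-- A pivotal coordinate of an event determined by `K` lies in `K` (for upper sets). [folklore] -/
theorem mem_of_isPivotal {ι : Type*} {A : Set (Set ι)} {K : Set ι} (hA : DeterminedBy A K)
    (hup : IsUpperSet A) {i : ι} {ω : Set ι} (h : IsPivotal A i ω) : i ∈ K := by
  by_contra hi
  rw [ProdWeight.isPivotal_iff_of_upper hup] at h
  have heq : insert i ω ∩ K = (ω \ {i}) ∩ K := by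
    ext j
    simp only [Set.mem_inter_iff, Set.mem_insert_iff, Set.mem_sdiff, Set.mem_singleton_iff]
    constructor
    · rintro ⟨rfl | hj, hjK⟩
      · exact absurd hjK hi
      · exact ⟨⟨hj, fun hji => hi (hji ▸ hjK)⟩, hjK⟩
    · rintro ⟨⟨hj, -⟩, hjK⟩
      exact ⟨Or.inr hj, hjK⟩
  rw [determinedBy_iff] at hA
  exact h.2 ((hA _ _ heq).1 h.1)

/-! ### The local modification property of `𝓔_L` -/

section LocMod

variable [H.LocallyFinite]

/-- **Lemma 6.1 in the form `AGLine.LocMod`**: on the window `enhWindow = E(B_{L+r}(o)) ⊔ B_L(o)`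
of `𝓔_L`, every finite configuration in which an edge coordinate is `p`-pivotal is modified, inside
`CE(e) ⊔ CV(e)`, marks only removed, into one with an `s`-pivotal mark in `CV(e)`.
[cite: MartineauSevero2019, Lemma 6.1] -/
theorem locMod_enhEvent (hH : H.Connected) (r : ℕ) (o : Q) {L : ℕ} (hL : r + 1 ≤ L) :
    AGLine.LocMod (edgesInBallFin H o (L + r)) (ballFin H o L) (enhEvent H r o L) (CE H r) (CV H r) := by
  intro e he S hSK hpiv
  have heE : e ∈ H.edgeSet := edgesInBall_subset_edgeSet H o (L + r) (mem_edgesInBallFin.1 he)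
  have hdet := determinedBy_enhEvent_enhWindow hH r o L
  have hKdef : AGLine.K (edgesInBallFin H o (L + r)) (ballFin H o L) = enhWindow H r o L := rfl
  obtain ⟨ξ', z, hoff, hmarks, hnear, hzpiv⟩ := exists_local_modification hH hL heE hpiv
  set K := enhWindow H r o L with hKdef'
  set S' : Finset (Sym2 Q ⊕ Q) := K.filter fun i => i ∈ ξ' with hS'
  have hS'mem : ∀ i, i ∈ S' ↔ i ∈ K ∧ i ∈ ξ' := fun i => by rw [hS', Finset.mem_filter]
  have hS'coe : (↑S' : Set (Sym2 Q ⊕ Q)) ∩ ↑K = ξ' ∩ ↑K := by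
    ext i
    simp only [Set.mem_inter_iff, Finset.mem_coe, hS'mem]
    tauto
  refine ⟨S', fun i hi => ((hS'mem i).1 hi).1, ?_, ?_, ?_, ?_⟩
  · -- the pivotal mark
    have hzpiv' : IsPivotal (enhEvent H r o L) (Sum.inr z) (↑S' : Set (Sym2 Q ⊕ Q)) :=
      (isPivotal_iff_of_determinedBy hdet _ hS'coe).2 hzpiv
    have hzK : (Sum.inr z : Sym2 Q ⊕ Q) ∈ (↑K : Set (Sym2 Q ⊕ Q)) :=
      mem_of_isPivotal hdet (isUpperSet_enhEvent H r o L) hzpiv'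
    rw [Finset.mem_coe, hKdef', inr_mem_enhWindow] at hzK
    refine ⟨z, mem_ballFin.2 hzK, ?_, hzpiv'⟩
    obtain ⟨x, hx, hzx⟩ := hnear
    rw [CV, Finset.mem_union, mem_ballFin, mem_ballFin]
    rcases mem_iff_out.1 hx with rfl | rfl
    · exact Or.inl (graphBall_mono _ _ (by omega) hzx)
    · exact Or.inr (graphBall_mono _ _ (by omega) hzx)
  · -- agreement off `CE ⊔ CV`
    intro i hi
    have hi' : i ∉ modWindow H r e := fun h => hi (modWindow_subset h)
    rw [hS'mem]
    constructor
    · intro hiS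
      exact ⟨hKdef ▸ hSK hiS, (hoff i hi').2 hiS⟩
    · rintro ⟨-, hiξ'⟩
      exact (hoff i hi').1 hiξ'
  · -- edge coordinates change only inside `CE`
    intro f hf
    have hi' := inl_not_mem_modWindow (H := H) (r := r) hf
    rw [hS'mem]
    constructor
    · intro hiS
      exact ⟨hKdef ▸ hSK hiS, (hoff _ hi').2 hiS⟩
    · rintro ⟨-, hiξ'⟩
      exact (hoff _ hi').1 hiξ'
  · -- marks are only removed
    intro y hy
    exact hmarks y ((hS'mem _).1 hy).2

end LocMod

/-! ### The `(p, s)`-measure and the polynomial `Θ_L` -/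

section Measure

open scoped Classical in
/-- The parameters of `ℙ_{p,s}`: `p` on edges of `ℋ`, `0` on non-edges, `s` on vertices.
[cite: MartineauSevero2019, §4 (ℙ_{p,s})] -/
def enhParams (H : SimpleGraph Q) (p s : unitInterval) : Sym2 Q ⊕ Q → unitInterval :=
  fun i => Sum.elim (fun e => if e ∈ H.edgeSet then p else 0) (fun _ => s) i

/-- **`ℙ_{p,s} = Ber(p)^{⊗E(ℋ)} ⊗ Ber(s)^{⊗V(ℋ)}`** on joint configurations `ξ ⊆ E ⊔ V`.
[cite: MartineauSevero2019, §4 (ℙ_{p,s})] -/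
def enhMeasure (H : SimpleGraph Q) (p s : unitInterval) : Measure (Set (Sym2 Q ⊕ Q)) :=
  prodBernoulli (enhParams H p s)

/-- `ℙ_{p,s}` is a probability measure. [folklore] -/
instance instIsProbabilityMeasureEnhMeasure (H : SimpleGraph Q) (p s : unitInterval) :
    IsProbabilityMeasure (enhMeasure H p s) := by
  unfold enhMeasure; infer_instance

/-- **The edge marginal of `ℙ_{p,s}` is `P_p^ℋ`.** [cite: MartineauSevero2019, §4 (ℙ_{p,s})] -/
theorem enhMeasure_map_enhOmega (H : SimpleGraph Q) (p s : unitInterval) :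
    (enhMeasure H p s).map enhOmega = bondPercolation H p := by
  classical
  have h1 : (enhOmega : Set (Sym2 Q ⊕ Q) → Set (Sym2 Q)) = StarCoins.inlPart := rfl
  rw [enhMeasure, h1, StarCoins.prodBernoulli_map_inlPart]
  have h2 : (enhParams H p s ∘ Sum.inl) = fun e => if e ∈ H.edgeSet then p else 0 := by
    funext e; rfl
  rw [h2, prodBernoulli_indicator_holds]
  rfl

variable [H.LocallyFinite]

/-- **`Θ_L(p, s) = ℙ_{p,s}(𝓔_L)`**: the polynomial of `EnhancementAGLine.lean` on the window is the
probability of `𝓔_L` (cylinder decomposition of an event determined by finitely many coordinates).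
[cite: MartineauSevero2019, §6 (θ_L(p,s) := ℙ_{p,s}(𝓔_L))] -/
theorem theta_eq_enhMeasure_real (hH : H.Connected) (r : ℕ) (o : Q) (L : ℕ) (p s : unitInterval) :
    AGLine.Theta (edgesInBallFin H o (L + r)) (ballFin H o L) (enhEvent H r o L) p s =
      (enhMeasure H p s).real (enhEvent H r o L) := by
  classical
  rw [enhMeasure, RussoPath.prodBernoulli_real_eq_sum_powerset (determinedBy_enhEvent_enhWindow hH r o L),
    AGLine.Theta, ProdWeight.gTheta]
  refine Finset.sum_congr rfl fun S _ => ?_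
  split_ifs
  · unfold ProdWeight.gW ProdWeight.gwt
    refine Finset.prod_congr rfl fun i hi => ?_
    have hpar : AGLine.par (p : ℝ) (s : ℝ) i = ((enhParams H p s i : unitInterval) : ℝ) := by
      cases i with
      | inl e =>
        have he : e ∈ H.edgeSet := edgesInBall_subset_edgeSet H o (L + r) (inl_mem_enhWindow.1 hi)
        simp [AGLine.par, enhParams, he]
      | inr v => simp [AGLine.par, enhParams]
    rw [hpar]
    split_ifs <;> rfl
  · rfl

/-- **`θ_ℋ(o, p) ≤ ℙ_{p,s}(𝓔_L)`** for every `s` and `L`: an infinite open cluster of `o` reaches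
distance `≥ L`, and the `ω`-cluster is contained in the enhanced cluster ("`θ(p₀, 0) > 0` where we use
`p₀ > p_c(ℋ)`"). [cite: MartineauSevero2019, §6 (θ(𝐩(0),𝐬(0)) ≥ θ(p₀,0) > 0)] -/
theorem theta_le_enhMeasure_real [Countable Q] (hH : H.Connected) (r : ℕ) (o : Q) (L : ℕ)
    (p s : unitInterval) : theta H o p ≤ (enhMeasure H p s).real (enhEvent H r o L) := by
  set far : Set (Set (Sym2 Q)) := {ω | ∃ v, (openGraph ω).Reachable o v ∧ L ≤ H.dist o v} with hfar
  set good : Set (Set (Sym2 Q)) := {ω | ω ⊆ H.edgeSet} with hgood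
  -- `θ ≤ P(far)`
  have hsub : (percolatesAt o : Set (Set (Sym2 Q))) ⊆ far := by
    intro ω hω
    by_contra hnot
    simp only [hfar, Set.mem_setOf_eq, not_exists, not_and, not_le] at hnot
    refine hω (Set.Finite.subset (graphBall_finite H o L) fun v hv => ?_)
    obtain ⟨w, hw⟩ := hH.exists_walk_length_eq_dist o v
    exact ⟨w, by have := hnot v hv; omega⟩
  have hfar_meas : MeasurableSet far := by
    have : far = ⋃ v : Q, (if L ≤ H.dist o v then openConn o v else ∅) := by
      ext ω
      simp only [hfar, Set.mem_setOf_eq, Set.mem_iUnion]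
      constructor
      · rintro ⟨v, hv, hvL⟩
        exact ⟨v, by rw [if_pos hvL]; exact hv⟩
      · rintro ⟨v, hv⟩
        split_ifs at hv with h
        · exact ⟨v, hv, h⟩
        · simp at hv
    rw [this]
    refine MeasurableSet.iUnion fun v => ?_
    split_ifs
    · exact measurableSet_openConn_holds _ _
    · exact MeasurableSet.empty
  -- `far ∩ good` pulls back into `𝓔_L`
  have hpre : enhOmega ⁻¹' (far ∩ good) ⊆ enhEvent H r o L := by
    intro ξ hξ
    obtain ⟨⟨v, hv, hvL⟩, hωE⟩ := hξ
    refine ⟨v, ?_, hvL⟩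
    obtain ⟨w⟩ := hv
    -- walk along open edges
    suffices key : ∀ (a b : Q) (w : (openGraph (enhOmega ξ)).Walk a b),
        a ∈ enhCluster H r {o} (enhOmega ξ) (enhAlpha ξ) → b ∈ enhCluster H r {o} (enhOmega ξ) (enhAlpha ξ) from
      key o v w (subset_enhCluster H r {o} _ _ rfl)
    intro a b w
    induction w with
    | nil => exact id
    | @cons a c d hac _ ih =>
      intro ha
      rw [openGraph_adj] at hac
      exact ih (mem_enhCluster_of_adj ha (hωE hac.1) hac.1)
  -- `good` has full measure under the edge marginal (no measurability of `good` needed)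
  have hmap := enhMeasure_map_enhOmega H p s
  have hgood1 : (bondPercolation H p) goodᶜ = 0 := by
    have := ProbabilityTheory.setBernoulli_ae_subset (u := H.edgeSet) (p := p)
    rw [Filter.Eventually, mem_ae_iff] at this
    exact this
  have hmeas_enh : Measurable (enhOmega : Set (Sym2 Q ⊕ Q) → Set (Sym2 Q)) :=
    measurable_set_iff.2 fun e => measurable_set_mem _
  have hgoodμ : (enhMeasure H p s) (enhOmega ⁻¹' good)ᶜ = 0 := by
    rw [← Set.preimage_compl]
    refine le_antisymm ?_ bot_le
    calc (enhMeasure H p s) (enhOmega ⁻¹' goodᶜ) ≤ ((enhMeasure H p s).map enhOmega) goodᶜ :=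
          Measure.le_map_apply hmeas_enh.aemeasurable _
      _ = 0 := by rw [hmap]; exact hgood1
  calc theta H o p = (bondPercolation H p).real (percolatesAt o) := rfl
    _ ≤ (bondPercolation H p).real far := measureReal_mono hsub
    _ = (enhMeasure H p s).real (enhOmega ⁻¹' far) := by rw [← hmap, map_measureReal_apply hmeas_enh hfar_meas]
    _ = (enhMeasure H p s).real (enhOmega ⁻¹' far ∩ enhOmega ⁻¹' good) := by
        rw [measureReal_def, measureReal_def, measure_inter_conull hgoodμ]
    _ ≤ (enhMeasure H p s).real (enhEvent H r o L) :=
        measureReal_mono (by rw [← Set.preimage_inter]; exact hpre)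

end Measure

/-! ### Proposition 4.2 -/

section Prop42

variable [H.LocallyFinite]

/-- **Martineau–Severo 2019, Proposition 4.2 (finite-volume form).** Let `ℋ` be connected, locally
finite, on a countable vertex type, with all degrees `≤ D`, root `o`, `p_c(ℋ, o) < 1`, and let
`r` be any enhancement radius. Then for every `ε ∈ (0, p_c(ℋ, o))` and every `s ∈ (0, 1]` there are
`p ∈ [ε, p_c(ℋ, o))` and `η > 0` with `ℙ_{p,s}(𝓔_L) ≥ η` for all `L ≥ r + 1` — so
`𝒞_ℋ^{p,s}(o)` is infinite with probability `≥ η > 0` although `p < p_c(ℋ)`. Proof (§6): with `μ₀`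
below `min(p, 1-p)` along the segment, `C = AGconst` from Lemma 6.1 (`locMod_enhEvent`) and the
degree bounds, `κ = 1/C`, `s' = min(s, 1/2, (p_c-ε)/(2κ))`, `p₀ ∈ (p_c, p_c + κ s')`, `p = p₀ - κ s'`:
`ℙ_{p,s}(𝓔_L) ≥ Θ_L(p, s') ≥ Θ_L(p₀, 0) ≥ θ_ℋ(o, p₀) =: η > 0`.
[cite: MartineauSevero2019, Prop. 4.2 (proof in §6)] -/
theorem exists_lt_criticalProb_enhEvent_ge [Countable Q] (hH : H.Connected) {D : ℕ}
    (hD : ∀ v, H.degree v ≤ D) (o : Q) (r : ℕ) (hpc1 : criticalProb H o < 1)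
    {ε : ℝ} (hε0 : 0 < ε) (hε : ε < criticalProb H o) (s : unitInterval) (hs : 0 < (s : ℝ)) :
    ∃ p : unitInterval, ε ≤ (p : ℝ) ∧ (p : ℝ) < criticalProb H o ∧ ∃ η : ℝ, 0 < η ∧
      ∀ L : ℕ, r + 1 ≤ L → η ≤ (enhMeasure H p s).real (enhEvent H r o L) := by
  set pc : ℝ := criticalProb H o with hpc
  -- the window data and the constants
  set NE : ℕ := 2 * ((D + 1) ^ (2 * r + 2) + 1) ^ 2 with hNE
  set NV : ℕ := 2 * (D + 1) ^ (3 * r + 4) with hNV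
  set NM : ℕ := ((D + 1) ^ (3 * r + 5) + 1) ^ 2 with hNM
  set μ₀ : ℝ := min (ε / 2) ((1 - pc) / 4) with hμ₀
  have hμ₀_pos : 0 < μ₀ := lt_min (by linarith) (by linarith)
  have hμ₀_le : μ₀ ≤ 1 := (min_le_left _ _).trans (by linarith [hε.trans hpc1])
  set C : ℝ := AGLine.AGconst NE NV NM μ₀ with hC
  have hNM1 : (1 : ℝ) ≤ NM := by
    have : 1 ≤ NM := Nat.one_le_pow _ _ (Nat.succ_pos _)
    exact_mod_cast this
  have hC_pos : 0 < C := by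
    rw [hC, AGLine.AGconst]
    have h1 : (0 : ℝ) < (μ₀ ^ NE)⁻¹ := inv_pos.2 (pow_pos hμ₀_pos _)
    have h2 : (0 : ℝ) < 2 ^ (NE + NV) := by positivity
    have h3 : (0 : ℝ) < NM := by linarith
    exact mul_pos (mul_pos h1 h2) h3
  set κ : ℝ := 1 / C with hκ
  have hκ_pos : 0 < κ := by rw [hκ]; positivity
  have hκC : κ * C ≤ 1 := by rw [hκ, one_div, inv_mul_cancel₀ hC_pos.ne']
  set s' : ℝ := min (s : ℝ) (min (1 / 2) ((pc - ε) / (2 * κ))) with hs'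
  have hs'_pos : 0 < s' := lt_min hs (lt_min (by norm_num) (by have := sub_pos.2 hε; positivity))
  have hs'_le_s : s' ≤ s := min_le_left _ _
  have hs'_half : s' ≤ 1 / 2 := (min_le_right _ _).trans (min_le_left _ _)
  have hκs' : κ * s' ≤ (pc - ε) / 2 := by
    have : s' ≤ (pc - ε) / (2 * κ) := (min_le_right _ _).trans (min_le_right _ _)
    have hκne : κ ≠ 0 := hκ_pos.ne'
    calc κ * s' ≤ κ * ((pc - ε) / (2 * κ)) := mul_le_mul_of_nonneg_left this hκ_pos.le
      _ = (pc - ε) / 2 := by rw [mul_div_assoc', mul_comm κ (pc - ε), mul_div_mul_right _ _ hκne]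
  set p₀ : ℝ := pc + min (κ * s' / 2) ((1 - pc) / 2) with hp₀
  have hp₀_gt : pc < p₀ := by
    rw [hp₀]; have : 0 < min (κ * s' / 2) ((1 - pc) / 2) := lt_min (by positivity) (by linarith); linarith
  have hp₀_lt : p₀ < pc + κ * s' := by
    rw [hp₀]; have : min (κ * s' / 2) ((1 - pc) / 2) ≤ κ * s' / 2 := min_le_left _ _
    have : 0 < κ * s' := by positivity
    linarith
  have hp₀_le : p₀ ≤ (1 + pc) / 2 := by
    rw [hp₀]; have := min_le_right (κ * s' / 2) ((1 - pc) / 2); linarith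
  have hp₀_le1 : p₀ ≤ 1 := hp₀_le.trans (by linarith)
  set p' : ℝ := p₀ - κ * s' with hp'
  have hp'_lt : p' < pc := by rw [hp']; linarith
  have hp'_ge : ε ≤ p' := by rw [hp']; linarith
  have hp'_pos : 0 < p' := hε0.trans_le hp'_ge
  have hp'_le1 : p' ≤ 1 := by
    have : 0 ≤ κ * s' := by positivity
    rw [hp']; linarith
  have hμ₀p' : μ₀ ≤ p' := (min_le_left _ _).trans (by linarith)
  have hμ₀p₀ : p₀ ≤ 1 - μ₀ := by
    have : μ₀ ≤ (1 - pc) / 4 := min_le_right _ _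
    linarith
  -- `θ_ℋ(p₀) > 0`
  set P₀ : unitInterval := ⟨p₀, by linarith, hp₀_le1⟩ with hP₀
  have hθ₀ : 0 < theta H o P₀ :=
    theta_pos_of_criticalProb_lt_holds H o P₀ (by simpa [hP₀] using hp₀_gt)
  set P' : unitInterval := ⟨p', hp'_pos.le, hp'_le1⟩ with hP'
  refine ⟨P', hp'_ge, hp'_lt, theta H o P₀, hθ₀, fun L hL => ?_⟩
  -- the chain of inequalities at scale `L`
  have hAup : IsUpperSet (enhEvent H r o L) := isUpperSet_enhEvent H r o L
  have hmod := locMod_enhEvent hH r o hL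
  have hKE_edge : ∀ e ∈ edgesInBallFin H o (L + r), e ∈ H.edgeSet := fun e he =>
    edgesInBall_subset_edgeSet H o (L + r) (mem_edgesInBallFin.1 he)
  have hNEb : ∀ e ∈ edgesInBallFin H o (L + r), (CE H r e).card ≤ NE := fun e _ => card_CE_le hD e
  have hNVb : ∀ e ∈ edgesInBallFin H o (L + r), (CV H r e).card ≤ NV := fun e _ => card_CV_le hD e
  have hNMb : ∀ y ∈ ballFin H o L, ((edgesInBallFin H o (L + r)).filter fun e => y ∈ CV H r e).card ≤ NM :=
    fun y _ => card_filter_mem_CV_le hD hKE_edge y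
  calc theta H o P₀ ≤ (enhMeasure H P₀ 0).real (enhEvent H r o L) := theta_le_enhMeasure_real hH r o L P₀ 0
    _ = AGLine.Theta (edgesInBallFin H o (L + r)) (ballFin H o L) (enhEvent H r o L) p₀ 0 := by
        rw [← theta_eq_enhMeasure_real hH r o L P₀ 0]
        rfl
    _ ≤ AGLine.Theta (edgesInBallFin H o (L + r)) (ballFin H o L) (enhEvent H r o L) (p₀ - κ * s') s' :=
        AGLine.theta_line_mono hAup hmod hNEb hNVb hNMb hμ₀_pos hμ₀_le hκ_pos.le hκC hs'_pos.le
          hs'_half hμ₀p' hμ₀p₀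
    _ ≤ AGLine.Theta (edgesInBallFin H o (L + r)) (ballFin H o L) (enhEvent H r o L) (p₀ - κ * s') s :=
        AGLine.theta_mono_s hAup hp'_pos.le hp'_le1 hs'_pos.le hs'_le_s s.2.2
    _ = (enhMeasure H P' s).real (enhEvent H r o L) := by
        rw [← theta_eq_enhMeasure_real hH r o L P' s]

end Prop42


end EnhProp42

end Literature.Probability.Percolation
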